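import Summits.RiemannHypothesis.RiemannHypothesis.Theses.WeilWindowFlow
import Literature.NumberTheory.LFunctions.WeilMarkovQuadratic

/-!
# Sketch (crux-ideate, ideator 3, round 1) — first lemmas for the crux `GronwallLeakage`
(item stmt-RiemannHypothesis-1037, route WeilWindowFlow).

Three idea cards, three groups of typed statements (Props only, no proofs — crux-ideate files no
skeleton):

* `integer-ladder-quantised-leakage`: `GronwallOn`, `LadderLeakage`, `LadderGlue`,
  `FrozenArithmetic`, `UniformLadderLeakage`, `QuantisedLeakage`, `UniformLadderGlue`;
* `frozen-form-survival-margins`: `frozenQuadratic`, `frozenBottom`, `FrozenAgreement`,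
  `FrozenPositivity`, `SurvivalMargin`, `SurvivalGlue`, `evenBottom`, `oddBottom`, `ParitySplit`;
* `dini-ne-saks-split`: `StrictPos`, `LogAC`, `ACSplit`, `FiniteDiniOffCountable`, `SaksGlue`.

`ε = Literature.NumberTheory.LFunctions.weilGroundEnergy`; `μ = e^{2a}`; the prime power `n`
enters the window `[-a, a]` at `2a = log n`.
-/

noncomputable section

open MeasureTheory Set Filter
open scoped Topology

namespace Summit.RiemannHypothesis.RiemannHypothesis.Cruxes.GronwallLeakage.SketchIdeator3

open Literature.NumberTheory.LFunctions
open Summit.RiemannHypothesis.RiemannHypothesis.Theses.WeilWindowFlow (GronwallLeakage)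

/-! ## Card `integer-ladder-quantised-leakage` -/

/-- The Grönwall leakage law restricted to the closed window range `[b₀, A]`. -/
def GronwallOn (b₀ A : ℝ) : Prop :=
  ∃ C : ℝ → ℝ, ∀ b a : ℝ, b₀ ≤ b → b ≤ a → a ≤ A → 0 < b →
    IntervalIntegrable C volume b a ∧
      weilGroundEnergy b * Real.exp (-(∫ x in b..a, C x)) ≤ weilGroundEnergy a

/-- The integer ladder: the leakage law on each frozen-arithmetic step
`I_n = [½ log n, ½ log (n+1)]` (`n ≥ 1`; `I_1 = [0, ½ log 2]` is the prime-free range). -/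
def LadderLeakage : Prop :=
  ∀ n : ℕ, 1 ≤ n → GronwallOn (Real.log n / 2) (Real.log (n + 1) / 2)

/-- Ladder glue (pure real analysis: concatenate the rates `C_n` into one locally integrable `C`
and chain the multiplicative inequalities across the breakpoints `½ log n`). -/
def LadderGlue : Prop := LadderLeakage → GronwallLeakage

/-- Frozen arithmetic: on `(½ log n, ½ log (n+1)]` the prime index and the killing constant of the
Markov decomposition do not move (provable now from `mem_weilPrimeIndex`). -/
def FrozenArithmetic : Prop :=
  ∀ (n : ℕ) (a : ℝ), 1 ≤ n → Real.log n / 2 < a → a ≤ Real.log (n + 1) / 2 →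
    weilPrimeIndex a = Finset.range (n + 1) ∧
      weilMarkovConstant a = weilMarkovConstant (Real.log (n + 1) / 2)

/-- The sharp transfer `C⁺`: a UNIFORM rate `K · n` on the step `I_n` for `n ≥ 2` (numerics and
Connes's prolate law suggest `K → 4π·2 = 8π` per unit `a`, i.e. `4π` per unit `μ`). The prime-free step
`n = 1` is EXCLUDED on purpose: there `ε(b) → +∞` as `b → 0⁺` (coercivity), so no rate bounded on
`(0, ½log 2]` can work — the standing disprover's `not_gronwallLeakageBoundedRate` /
`gronwallLeakage_false_without_posB` (Cruxes/GronwallLeakage/Disproof.lean); the step `I_1` is carried by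
the non-uniform `GronwallOn 0 (log 2 / 2)` (rate free to blow up at `0⁺`). -/
def UniformLadderLeakage (K : ℝ) : Prop :=
  ∀ n : ℕ, 2 ≤ n → ∀ b a : ℝ, Real.log n / 2 ≤ b → b ≤ a → a ≤ Real.log (n + 1) / 2 →
    weilGroundEnergy b * Real.exp (-(K * n * (a - b))) ≤ weilGroundEnergy a

/-- Per-integer leakage quantum: "one integer costs at most a factor `e^K`"
(conjecturally `K = 4π + o(1)`: `q_n := log (ε(½log n)/ε(½log(n+1))) → 4π`). -/
def QuantisedLeakage : Prop :=
  ∃ K : ℝ, ∀ n : ℕ, 2 ≤ n →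
    weilGroundEnergy (Real.log n / 2) * Real.exp (-K) ≤ weilGroundEnergy (Real.log (n + 1) / 2)

/-- The uniform law on the steps `n ≥ 2` plus the (non-uniform) prime-free step give the ladder, hence
the crux, with the rate `C(a) = K ⌈e^{2a}⌉` on `[½log 2, ∞)` and the free rate `C₁` on `(0, ½log 2]`. -/
def UniformLadderGlue : Prop :=
  ∀ K : ℝ, UniformLadderLeakage K → GronwallOn 0 (Real.log 2 / 2) → LadderLeakage

/-! ## Card `frozen-form-survival-margins` -/

/-- The frozen-at-`q` Weil form (real part): pole form + pure-jump Dirichlet form with the prime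
powers `≤ q` only + archimedean density − the corresponding killing constant. By
`weilQuadratic_re_eq_weilPoleForm_add_weilDirichletEnergy_sub` it equals `Re Q(g)` for every test
function supported in a window of half-width `≤ ½ log (q+1)` (books balance: a lag `log m ≥ 2a`
contributes `2‖g‖²` on both sides), but it is defined — and has a bottom — at EVERY window. -/
def frozenQuadratic (q : ℕ) (g : ℝ → ℂ) : ℝ :=
  weilPoleForm g + weilDirichletEnergy (Real.log (q + 1) / 2) g
    - weilMarkovConstant (Real.log (q + 1) / 2) * ∫ t, ‖g t‖ ^ 2

/-- Window bottom of the frozen-at-`q` form. -/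
def frozenBottom (q : ℕ) (a : ℝ) : ℝ :=
  sInf {x : ℝ | ∃ g : ℝ → ℂ, IsWeilTest g ∧ tsupport g ⊆ Icc (-a) a ∧
    ∫ t, ‖g t‖ ^ 2 = 1 ∧ x = frozenQuadratic q g}

/-- Agreement: below the entry of `q+1` the frozen bottom IS the ground energy. -/
def FrozenAgreement : Prop :=
  ∀ (q : ℕ) (a : ℝ), 1 ≤ q → 0 < a → a ≤ Real.log (q + 1) / 2 →
    frozenBottom q a = weilGroundEnergy a

/-- Frozen positivity up to the entry of `q+1` (`⟺ WeilPositivityOn (½ log (q+1))` given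
agreement; the conjunction over `q` is RH by Yoshida's criterion). -/
def FrozenPositivity (q : ℕ) : Prop :=
  ∀ a : ℝ, 0 < a → a ≤ Real.log (q + 1) / 2 → 0 ≤ frozenBottom q a

/-- Survival margin: the frozen-at-`q` form stays non-negative STRICTLY BEYOND the entry of the
next integer, i.e. its conjugate modulus `μ*(q)` exceeds `q+1` (numerics: `μ*_odd(1) = 2.103`,
`μ*_even(1) = 2.271`, margins macroscopic in the window currency although `ε` itself is
super-exponentially small). -/
def SurvivalMargin (q : ℕ) : Prop :=
  ∃ δ : ℝ, 0 < δ ∧ ∀ a : ℝ, Real.log (q + 1) / 2 < a → a ≤ Real.log (q + 1) / 2 + δ →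
    0 ≤ frozenBottom q a

/-- Glue: frozen positivity at every rung gives the positivity half of the crux. -/
def SurvivalGlue : Prop :=
  FrozenAgreement → (∀ q : ℕ, 1 ≤ q → FrozenPositivity q) → ∀ a : ℝ, 0 < a → 0 ≤ weilGroundEnergy a

/-- Even-sector window bottom. -/
def evenBottom (a : ℝ) : ℝ :=
  sInf {x : ℝ | ∃ g : ℝ → ℂ, IsWeilTest g ∧ tsupport g ⊆ Icc (-a) a ∧ (∀ t, g (-t) = g t) ∧
    ∫ t, ‖g t‖ ^ 2 = 1 ∧ x = (weilQuadratic g).re}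

/-- Odd-sector window bottom. -/
def oddBottom (a : ℝ) : ℝ :=
  sInf {x : ℝ | ∃ g : ℝ → ℂ, IsWeilTest g ∧ tsupport g ⊆ Icc (-a) a ∧ (∀ t, g (-t) = -g t) ∧
    ∫ t, ‖g t‖ ^ 2 = 1 ∧ x = (weilQuadratic g).re}

/-- Parity split of the bottom (provable now from `weilQuadratic_re_add_of_even_odd`):
kinks of `ε` are parity crossings; each card's statements may be run per parity. -/
def ParitySplit : Prop := ∀ a : ℝ, 0 < a → weilGroundEnergy a = min (evenBottom a) (oddBottom a)

/-! ## Card `dini-ne-saks-split` -/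

/-- Strict positivity of the bottom at every window (⟹ RH by Yoshida; ⟸ RH by sampling). -/
def StrictPos : Prop := ∀ a : ℝ, 0 < a → 0 < weilGroundEnergy a

/-- Local absolute continuity of `log ε` (Mathlib's `AbsolutelyContinuousOnInterval`). -/
def LogAC : Prop :=
  ∀ b a : ℝ, 0 < b → b ≤ a →
    AbsolutelyContinuousOnInterval (fun x ↦ Real.log (weilGroundEnergy x)) b a

/-- The crux is EXACTLY strict positivity plus local absolute continuity of `log ε`
(→: `|log ε a − log ε b| ≤ ∫_b^a |C|`; ←: `C := −deriv (log ∘ ε)`,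
`AbsolutelyContinuousOnInterval.integral_deriv_eq_sub`, `.intervalIntegrable_deriv`).
NOW A THEOREM: the standing disprover's `gronwallLeakage_iff_pos_and_logAC`
(Cruxes/GronwallLeakage/Disproof.lean, §4) is `ACSplit.symm` verbatim. -/
def ACSplit : Prop := (StrictPos ∧ LogAC) ↔ GronwallLeakage

/-- Pointwise, exception-tolerant regularity: off a countable set of windows the lower right Dini
derivate of `ε` is finite (no uniformity, no integrability asked). -/
def FiniteDiniOffCountable : Prop :=
  ∃ s : Set ℝ, s.Countable ∧ ∀ a : ℝ, 0 < a → a ∉ s →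
    ∃ M : ℝ, ∀ᶠ h in 𝓝[>] (0 : ℝ), -(M * h) ≤ weilGroundEnergy (a + h) - weilGroundEnergy a

/-- Saks–Banach–Zarecki glue: a continuous antitone function with finite lower right Dini derivate
nearly everywhere has Lusin's property (N), hence is absolutely continuous; with strict positivity
`log ε` is locally AC and the crux follows by `ACSplit`. -/
def SaksGlue : Prop := StrictPos → FiniteDiniOffCountable → GronwallLeakage

end Summit.RiemannHypothesis.RiemannHypothesis.Cruxes.GronwallLeakage.SketchIdeator3

end
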